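import Summits.HubbardSuperconductivity.HubbardSuperconductivity.Theses.JosephsonMirror
import Summits.HubbardSuperconductivity.HubbardSuperconductivity.Theorems.JosephsonMirrorPairBridgeGivesGain
import Summits.HubbardSuperconductivity.HubbardSuperconductivity.Theorems.JosephsonMirrorFreeLayersDecoupling
import Summits.HubbardSuperconductivity.HubbardSuperconductivity.Theorems.JosephsonMirrorFreeLayersGCBound
import Summits.HubbardSuperconductivity.HubbardSuperconductivity.Theorems.JosephsonMirrorFreeLayersEnsemble

/-!
# Route `JosephsonMirror` — the probe does not fire on free layers (`JmFreeLayersNoCusp`)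

Support item stmt-HubbardSuperconductivity-2232 of route `JosephsonMirror` (sub-problem
`HubbardSuperconductivity`): the `U = 0` calibration of the Josephson mirror. For free layers, every
`δ ∈ (0, 1/2)` and every `a > 0` there are `J > 0` and `L₀` such that for all even `L ≥ L₀` the
window double `H_L(J) = A ⊗ 1 + 1 ⊗ Aᵀ - J (D ⊗ D̄ + Dᴴ ⊗ D̄ᴴ)` (`A = H(1,0) - μ_L N`,
`D = L⁻¹ Δ_d`, balancing `μ_L`, window `S_L = (N_L, N_L) ⊕ (N_L - 2, N_L - 2)` at `S^z = 0`) gains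
less than linearly: `E_L(0) - E_L(J) < a J L²`.

Proof (elementary; no mean-field exactness is used — the claim is `o(J)`, not `e^{-c/J}`):
* operator AM–GM `D ⊗ D̄ + h.c. ≤ D Dᴴ ⊗ 1 + 1 ⊗ (Dᴴ D)ᵀ` decouples the layers, and the window
  energy is bounded through block floors of `A - J D Dᴴ`, `A - J Dᴴ D` and the trial state `φ ⊗ φ̄`
  (`JosephsonMirrorFreeLayersDecoupling.minEnergyOn_sub_le_of_floors`);
* each decoupled layer is the free torus with a reduced `d`-wave BCS term of strength `8J/L²`; its
  grand-canonical energy at any `μ'` exceeds the Fermi-sea value `Σ_k 2min(ξ_k,0)` minus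
  `(128 J + 96 J s²/L²)` per unit norm for `96 J ≤ Λ` (`JosephsonMirrorFreeLayersGCBound`), and the
  shell is thin, `s²/L² ≤ 2ΛL² + 8` (`TorusShellCountUniform`);
* the canonical block energies `e(2m') - 2m'μ_L` (`m' ∈ {m, m-1}`, both equal to `a₀` by the
  balancing `μ_L`) are at most the Fermi-sea value plus `(μ' - μ_L) 2m'` for a suitable `μ'`
  (`JosephsonMirrorFreeLayersEnsemble`), so both blocks have floor `a₀ - (896 J + 192 Λ J L²)`;
* with `Λ = a/800`, `J = Λ/96` and `a L² > 3712`: `E(0) - E(J) ≤ 2 (896 J + 192 Λ J L²) < a J L²`.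

Sources: J. Bardeen, L. N. Cooper, J. R. Schrieffer, Phys. Rev. 108 (1957) 1175, §II; E. H. Lieb,
Phys. Rev. Lett. 62 (1989) 1201 (the `W`-matrix packaging); T. Koma, H. Tasaki, J. Stat. Phys. 76
(1994) 745. No new definitions.
-/

-- the mandated namespace `Summit.<Summit>.<Problem>.Theorems` repeats `HubbardSuperconductivity`
-- (single-problem summit, D-0017), which the `dupNamespace` linter flags on every declaration
set_option linter.dupNamespace false

namespace Summit.HubbardSuperconductivity.HubbardSuperconductivity.Theorems.JosephsonMirror

open Matrix Finset Literature.MathematicalPhysics.QuantumLattice Literature.Probability.LatticeModels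
open scoped ComplexOrder ComplexConjugate

/-! ### Assembly: the free layers show no Josephson cusp -/

section Assembly

open Summit.HubbardSuperconductivity.HubbardSuperconductivity.Theses.JosephsonMirror
open scoped Kronecker

variable {L : ℕ} [NeZero L]

/-- The shell `{k : -Λ < ξ_k < Λ}` (complement of `{ξ ≥ Λ} ∪ {ξ ≤ -Λ}`) is small uniformly in the
level: `#shell² / L² ≤ 2ΛL² + 8` for `0 < Λ` (`card_torusShell_le_sqrt`: `#shell ≤ √Λ L² + 2L`).
[folklore] -/
theorem shell_card_sq_div_le (μ : ℝ) {Λ : ℝ} (hΛ : 0 < Λ) :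
    (((univ.filter fun k : TorusSite 2 L => ¬ (Λ ≤ torusBand L k - μ) ∧
        ¬ (torusBand L k - μ ≤ -Λ)).card : ℝ) ^ 2 / (L : ℝ) ^ 2 ≤ 2 * Λ * (L : ℝ) ^ 2 + 8) := by
  have hL0 : (0 : ℝ) < L := by exact_mod_cast Nat.pos_of_ne_zero (NeZero.ne L)
  have hsub : (univ.filter fun k : TorusSite 2 L => ¬ (Λ ≤ torusBand L k - μ) ∧
      ¬ (torusBand L k - μ ≤ -Λ)) ⊆ univ.filter fun k : TorusSite 2 L => |torusBand L k - μ| ≤ Λ := by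
    intro k hk
    rw [Finset.mem_filter] at hk ⊢
    refine ⟨hk.1, abs_le.2 ⟨?_, ?_⟩⟩ <;> linarith [hk.2.1, hk.2.2]
  have hcard := card_torusShell_le_sqrt (L := L) μ Λ
  have hc : (((univ.filter fun k : TorusSite 2 L => ¬ (Λ ≤ torusBand L k - μ) ∧
      ¬ (torusBand L k - μ ≤ -Λ)).card : ℝ)) ≤ Real.sqrt Λ * (L : ℝ) ^ 2 + 2 * L :=
    le_trans (by exact_mod_cast Finset.card_le_card hsub) hcard
  have hc0 : (0 : ℝ) ≤ ((univ.filter fun k : TorusSite 2 L => ¬ (Λ ≤ torusBand L k - μ) ∧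
      ¬ (torusBand L k - μ ≤ -Λ)).card : ℝ) := Nat.cast_nonneg _
  have hsq : Real.sqrt Λ ^ 2 = Λ := Real.sq_sqrt hΛ.le
  have hs0 : 0 ≤ Real.sqrt Λ := Real.sqrt_nonneg Λ
  rw [div_le_iff₀ (by positivity)]
  have h1 : (((univ.filter fun k : TorusSite 2 L => ¬ (Λ ≤ torusBand L k - μ) ∧
      ¬ (torusBand L k - μ ≤ -Λ)).card : ℝ)) ^ 2 ≤ (Real.sqrt Λ * (L : ℝ) ^ 2 + 2 * L) ^ 2 :=
    pow_le_pow_left₀ hc0 hc 2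
  have h2 : (Real.sqrt Λ * (L : ℝ) ^ 2 + 2 * L) ^ 2 ≤ (2 * Λ * (L : ℝ) ^ 2 + 8) * (L : ℝ) ^ 2 := by
    nlinarith [sq_nonneg (Real.sqrt Λ * (L : ℝ) ^ 2 - 2 * L), hsq]
  linarith

/-- **Block floor of a free layer.** Let `M` be a pairing matrix for which the free grand-canonical
layer obeys, for every `μ'` and `w`,
`(Σ_k 2min(ξ_k,0) - (128J + 96J #shell²/L²)) ‖w‖² ≤ Re ⟨w, (H(1,0) - μ'N - J M) w⟩`.
Then on the vectors of the block `(2m', S^z = 0)` (`m' ≤ L²`, `L ≥ 3`) the canonical operator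
`A - J M`, `A = H(1,0) - μN`, is bounded below by `e(2m') - 2m'μ - (896J + 192ΛJL²)`
(ensemble comparison `minEnergyOn_szSector_free_le_fermiSea` and the uniform shell count).
[folklore] -/
theorem block_floor_free (hL : 3 ≤ L) (μ : ℝ) {Λ J : ℝ} (hΛ : 0 < Λ) (hJ : 0 ≤ J)
    (M : Matrix (Finset (Orb (FermionTorus 2 L))) (Finset (Orb (FermionTorus 2 L))) ℂ)
    (hGC : ∀ (μ' : ℝ) (w : Fock (Orb (FermionTorus 2 L))),
      (∑ k : TorusSite 2 L, 2 * min (torusBand L k - μ') 0 - (128 * J + 96 * J *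
        (((univ.filter fun k : TorusSite 2 L => ¬ (Λ ≤ torusBand L k - μ') ∧
          ¬ (torusBand L k - μ' ≤ -Λ)).card : ℝ) ^ 2 / (L : ℝ) ^ 2))) * (star w ⬝ᵥ w).re ≤
        (star w ⬝ᵥ (hubbardTorusWith 2 L 1 0 μ' - (J : ℂ) • M) *ᵥ w).re)
    {m' : ℕ} (hm' : m' ≤ L ^ 2) (v : Fock (Orb (FermionTorus 2 L))) (hv : IsInSector m' m' v) :
    ((hubbardTorus 2 L 1 0).minEnergyOn (szSector (2 * m') 0) - μ * (2 * m' : ℕ) -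
        (896 * J + 192 * Λ * J * (L : ℝ) ^ 2)) * (star v ⬝ᵥ v).re ≤
      (star v ⬝ᵥ (hubbardTorusWith 2 L 1 0 μ - (J : ℂ) • M) *ᵥ v).re := by
  obtain ⟨μ', hμ'⟩ := minEnergyOn_szSector_free_le_fermiSea hL hm'
  have hN : IsNParticle (2 * m') v := by
    have := hv.isNParticle
    rwa [← two_mul] at this
  have hn0 : 0 ≤ (star v ⬝ᵥ v).re := re_star_dotProduct_self_nonneg' v
  -- `A = (H(1,0) - μ'N) + (μ' - μ)N`
  have hA : (hubbardTorusWith 2 L 1 0 μ - (J : ℂ) • M) *ᵥ v =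
      (hubbardTorusWith 2 L 1 0 μ' - (J : ℂ) • M) *ᵥ v + (((μ' - μ) * (2 * m' : ℕ) : ℝ) : ℂ) • v := by
    simp only [hubbardTorusWith_eq, sub_mulVec, smul_mulVec, totalNumber_mulVec_of_isNParticle hN,
      smul_smul]
    push_cast
    module
  rw [hA, dotProduct_add, Complex.add_re, dotProduct_smul, smul_eq_mul, Complex.re_ofReal_mul]
  have h1 := hGC μ' v
  have h2 := shell_card_sq_div_le (L := L) μ' hΛ
  have h3 : 96 * J * (((univ.filter fun k : TorusSite 2 L => ¬ (Λ ≤ torusBand L k - μ') ∧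
      ¬ (torusBand L k - μ' ≤ -Λ)).card : ℝ) ^ 2 / (L : ℝ) ^ 2) ≤ 96 * J * (2 * Λ * (L : ℝ) ^ 2 + 8) :=
    mul_le_mul_of_nonneg_left h2 (by positivity)
  -- compare coefficients of `‖v‖²`
  have hcoef : (hubbardTorus 2 L 1 0).minEnergyOn (szSector (2 * m') 0) - μ * (2 * m' : ℕ) -
      (896 * J + 192 * Λ * J * (L : ℝ) ^ 2) ≤
      (∑ k : TorusSite 2 L, 2 * min (torusBand L k - μ') 0 - (128 * J + 96 * J *
        (((univ.filter fun k : TorusSite 2 L => ¬ (Λ ≤ torusBand L k - μ') ∧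
          ¬ (torusBand L k - μ' ≤ -Λ)).card : ℝ) ^ 2 / (L : ℝ) ^ 2))) + (μ' - μ) * (2 * m' : ℕ) := by
    push_cast at hμ' ⊢
    nlinarith [hμ', h3]
  nlinarith [mul_le_mul_of_nonneg_right hcoef hn0, h1]

/-- **`JmFreeLayersNoCusp`** (stmt-HubbardSuperconductivity-2232): the Josephson probe does not fire
on free layers. For `U = 0`, every `δ ∈ (0, 1/2)` and `a > 0` there are `J > 0` and `L₀` with
`E_L(0) - E_L(J) < a J L²` for all even `L ≥ L₀`. Proof: operator AM–GM decouples the two layers of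
the window double (`minEnergyOn_sub_le_of_floors`); each layer is the free torus with a reduced
`d`-wave BCS interaction of strength `J/L²`, whose gain over the Fermi sea is
`≤ (896J + 192ΛJL²)` per unit norm once `96J ≤ Λ` (shell split, weighted Cauchy–Schwarz, uniform
shell count) — with `Λ = a/800`, `J = Λ/96` and `aL² > 3712` this is `< aJL²/2` per layer. No
Bogoliubov-type mean-field exactness is needed: the claim is `o(J)`, not `e^{-c/J}`.
BCS (1957) §II; Lieb, PRL 62 (1989) 1201 (packaging). [folklore] -/
theorem jmFreeLayersNoCusp_proof :
    Summit.HubbardSuperconductivity.HubbardSuperconductivity.Theses.JosephsonMirror.JmFreeLayersNoCusp := by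
  unfold JmFreeLayersNoCusp
  intro δ hδ a ha
  obtain ⟨Λ, hΛdef⟩ : ∃ Λ : ℝ, Λ = a / 800 := ⟨_, rfl⟩
  have hΛ : 0 < Λ := by rw [hΛdef]; positivity
  refine ⟨Λ / 96, by positivity, ⌈3712 / a⌉₊ + 3, ?_⟩
  intro L _ hE hL₀ U ι N H μ A D Hd good S E
  obtain ⟨J, hJdef⟩ : ∃ J : ℝ, J = Λ / 96 := ⟨_, rfl⟩
  rw [← hJdef]
  have hJ : 0 < J := by rw [hJdef]; positivity
  have hJΛ : 96 * J ≤ Λ := by rw [hJdef]; linarith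
  -- sizes
  have hL3 : 3 ≤ L := le_trans (Nat.le_add_left 3 _) hL₀
  have hLr : (3712 / a : ℝ) < L := by
    have h1 : (3712 / a : ℝ) ≤ ⌈3712 / a⌉₊ := Nat.le_ceil _
    have h2 : ((⌈3712 / a⌉₊ : ℕ) : ℝ) + 3 ≤ L := by exact_mod_cast hL₀
    linarith
  have hL1 : (1 : ℝ) ≤ L := by exact_mod_cast (show 1 ≤ L by omega)
  have haL : 3712 < a * (L : ℝ) ^ 2 := by
    have h1 : 3712 < a * L := by
      have := (div_lt_iff₀' ha).1 hLr
      linarith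
    nlinarith
  have hL2 : (2 : ℝ) ≤ L := by exact_mod_cast (show 2 ≤ L by omega)
  -- the filling: `N = 2m` with `1 ≤ m ≤ L²`
  set m : ℕ := ⌊(1 - δ) * (L : ℝ) ^ 2 / 2⌋₊ with hm
  have hNm : N = 2 * m := rfl
  have hm1 : 1 ≤ m := by
    rw [hm]
    refine Nat.le_floor ?_
    rw [Nat.cast_one, le_div_iff₀ (by norm_num : (0 : ℝ) < 2)]
    have hδ2 : 1 / 2 ≤ 1 - δ := by linarith [hδ.2]
    nlinarith [hδ2, hL2]
  have hmL : m ≤ L ^ 2 := by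
    rw [hm]
    refine Nat.floor_le_of_le ?_
    have hδ0 : 1 - δ ≤ 1 := by linarith [hδ.1]
    have hL0 : (0 : ℝ) ≤ (L : ℝ) ^ 2 := by positivity
    push_cast
    nlinarith
  have hm'L : m - 1 ≤ L ^ 2 := le_trans (Nat.sub_le m 1) hmL
  have hN2 : N - 2 = 2 * (m - 1) := by omega
  have hN2' : ((N - 2 : ℕ) : ℝ) = (N : ℝ) - 2 := by
    rw [Nat.cast_sub (by omega)]
    norm_num
  -- energies and the balancing chemical potential
  set e₁ : ℝ := H.minEnergyOn (szSector N 0) with he₁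
  set e₂ : ℝ := H.minEnergyOn (szSector (N - 2) 0) with he₂
  have hμ : μ = (e₁ - e₂) / 2 := rfl
  set a₀ : ℝ := e₁ - μ * N with ha₀
  have ha₂ : a₀ = e₂ - μ * ((N - 2 : ℕ) : ℝ) := by
    rw [hN2', ha₀, hμ]
    ring
  have hAherm : A.IsHermitian := isHermitian_hamiltonianWith _ 1 U μ
  -- block predicates
  set F : ι → Prop := fun s =>
    (s.filter fun o => (ofLex o).2 = 0).card = (s.filter fun o => (ofLex o).2 = 1).card with hF
  set P₁ : ι → Prop := fun s => s.card = N ∧ F s with hP₁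
  set P₂ : ι → Prop := fun s => s.card = N - 2 ∧ F s with hP₂
  have h12 : ∀ s, P₁ s → ¬ P₂ s := by
    rintro s ⟨h1, -⟩ ⟨h2, -⟩
    omega
  have hgood : ∀ s t, good (s, t) → (P₁ s ∧ P₁ t) ∨ (P₂ s ∧ P₂ t) := by
    rintro s t ⟨h | h, hs, ht⟩
    · exact Or.inl ⟨⟨h.1, hs⟩, ⟨h.2, ht⟩⟩
    · exact Or.inr ⟨⟨h.1, hs⟩, ⟨h.2, ht⟩⟩
  have hgood₁ : ∀ s t, P₁ s → P₁ t → good (s, t) := fun s t hs ht =>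
    ⟨Or.inl ⟨hs.1, ht.1⟩, hs.2, ht.2⟩
  have hS : ∀ ψ, ψ ∈ S ↔ ∀ p, ¬ good p → ψ p = 0 := by
    intro ψ
    simp only [S, Submodule.mem_iInf, LinearMap.mem_ker, LinearMap.proj_apply]
  -- a unit ground state of the block `(N, 0)`
  have hcardm : m ≤ Fintype.card (FermionTorus 2 L) := by rwa [card_fermionTorus]
  obtain ⟨ψ₀, hψ₀mem, hψ₀ne, hHψ₀⟩ := (szSector_groundState (fermionTorusGraph 2 L) 1 U hcardm).1
  obtain ⟨c, -, hc1⟩ := exists_smul_unit hψ₀ne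
  set φ : Fock (Orb (FermionTorus 2 L)) := c • ψ₀ with hφ
  have hφmem : φ ∈ szSector N 0 := by rw [hNm]; exact Submodule.smul_mem _ c hψ₀mem
  have hHφ : H *ᵥ φ = ((e₁ : ℝ) : ℂ) • φ := by
    rw [hφ, mulVec_smul, he₁, hNm]
    change c • (hamiltonian (fermionTorusGraph 2 L) 1 U *ᵥ ψ₀) = _
    rw [hHψ₀, smul_comm]
    rfl
  have hφsec : IsInSector m m φ := (mem_szSector_two_mul_zero_iff m φ).1 (hNm ▸ hφmem)
  have hφP : ∀ s, ¬ P₁ s → φ s = 0 := fun s hs =>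
    hφsec s fun h => hs (by simpa [hP₁, hF, hNm] using (block_iff m s).2 h)
  have hφN : IsNParticle N φ := ((mem_szSector_iff N 0 φ).1 hφmem).1
  have hAφ : A *ᵥ φ = (a₀ : ℂ) • φ := by
    show hubbardTorusWith 2 L 1 U μ *ᵥ φ = (a₀ : ℂ) • φ
    rw [hubbardTorusWith_eq, sub_mulVec, smul_mulVec, totalNumber_mulVec_of_isNParticle hφN,
      smul_smul]
    change H *ᵥ φ - _ = _
    rw [hHφ, ← sub_smul, ha₀]
    push_cast
    rfl
  -- the decoupled floors
  set x : ℝ := a₀ - (896 * J + 192 * Λ * J * (L : ℝ) ^ 2) with hx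
  have hGC₁ : ∀ (μ' : ℝ) (w : Fock (Orb (FermionTorus 2 L))),
      (∑ k : TorusSite 2 L, 2 * min (torusBand L k - μ') 0 - (128 * J + 96 * J *
        (((univ.filter fun k : TorusSite 2 L => ¬ (Λ ≤ torusBand L k - μ') ∧
          ¬ (torusBand L k - μ' ≤ -Λ)).card : ℝ) ^ 2 / (L : ℝ) ^ 2))) * (star w ⬝ᵥ w).re ≤
        (star w ⬝ᵥ (hubbardTorusWith 2 L 1 0 μ' - (J : ℂ) • (D * Dᴴ)) *ᵥ w).re := by
    intro μ' w
    have h := re_expect_free_sub_pairing_ge hL3 μ' hΛ hJ.le hJΛ w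
    have hw0 : 0 ≤ (star w ⬝ᵥ w).re := re_star_dotProduct_self_nonneg' w
    refine le_trans ?_ h
    nlinarith [hw0, hJ.le]
  have hGC₂ : ∀ (μ' : ℝ) (w : Fock (Orb (FermionTorus 2 L))),
      (∑ k : TorusSite 2 L, 2 * min (torusBand L k - μ') 0 - (128 * J + 96 * J *
        (((univ.filter fun k : TorusSite 2 L => ¬ (Λ ≤ torusBand L k - μ') ∧
          ¬ (torusBand L k - μ' ≤ -Λ)).card : ℝ) ^ 2 / (L : ℝ) ^ 2))) * (star w ⬝ᵥ w).re ≤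
        (star w ⬝ᵥ (hubbardTorusWith 2 L 1 0 μ' - (J : ℂ) • (Dᴴ * D)) *ᵥ w).re :=
    fun μ' w => re_expect_free_sub_pairing_ge' hL3 μ' hΛ hJ.le hJΛ w
  have hblock : ∀ (M : Matrix (Finset (Orb (FermionTorus 2 L))) (Finset (Orb (FermionTorus 2 L))) ℂ),
      (∀ (μ' : ℝ) (w : Fock (Orb (FermionTorus 2 L))),
        (∑ k : TorusSite 2 L, 2 * min (torusBand L k - μ') 0 - (128 * J + 96 * J *
          (((univ.filter fun k : TorusSite 2 L => ¬ (Λ ≤ torusBand L k - μ') ∧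
            ¬ (torusBand L k - μ' ≤ -Λ)).card : ℝ) ^ 2 / (L : ℝ) ^ 2))) * (star w ⬝ᵥ w).re ≤
          (star w ⬝ᵥ (hubbardTorusWith 2 L 1 0 μ' - (J : ℂ) • M) *ᵥ w).re) →
      ∀ v : ι → ℂ, ((∀ s, ¬ P₁ s → v s = 0) ∨ (∀ s, ¬ P₂ s → v s = 0)) →
        x * (star v ⬝ᵥ v).re ≤ (star v ⬝ᵥ (A - (J : ℂ) • M) *ᵥ v).re := by
    intro M hM v hv
    rcases hv with hv | hv
    · have hsec : IsInSector m m v := fun s hs =>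
        hv s fun h => hs ((block_iff m s).1 (by simpa [hP₁, hF, hNm] using h))
      have h := block_floor_free hL3 μ hΛ hJ.le M hM hmL v hsec
      have he : (hubbardTorus 2 L 1 0).minEnergyOn (szSector (2 * m) 0) - μ * (2 * m : ℕ) = a₀ := by
        rw [ha₀, he₁, hNm]
      rw [he] at h
      exact h
    · have hsec : IsInSector (m - 1) (m - 1) v := fun s hs =>
        hv s fun h => hs ((block_iff (m - 1) s).1 (by simpa [hP₂, hF, hN2] using h))
      have h := block_floor_free hL3 μ hΛ hJ.le M hM hm'L v hsec
      have he : (hubbardTorus 2 L 1 0).minEnergyOn (szSector (2 * (m - 1)) 0) -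
          μ * (2 * (m - 1) : ℕ) = a₀ := by
        rw [ha₂, he₂, hN2]
      rw [he] at h
      exact h
  have key := minEnergyOn_sub_le_of_floors A D hAherm P₁ P₂ h12 good hgood hgood₁ S hS a₀ x x
    (hblock (D * Dᴴ) hGC₁) (hblock (Dᴴ * D) hGC₂) φ hφP hc1 hAφ hJ.le
  -- the budget: `2a₀ - 2x = 2 (896 J + 192 Λ J L²) < a J L²`
  have hbudget : 2 * a₀ - x - x < a * J * (L : ℝ) ^ 2 := by
    rw [hx, hΛdef]
    nlinarith [haL, hJ]
  exact lt_of_le_of_lt key hbudget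

end Assembly

end Summit.HubbardSuperconductivity.HubbardSuperconductivity.Theorems.JosephsonMirror
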